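import Summits.QuantumFields.YangMills.Theorems.FluctuationComparisonRegPrIntLOrganTangentPullbackSquareCurvOrgan
import HarnessLib

/-!
# Crux `FluctuationComparisonRegPrIntL` (stmt-QuantumFields-20520, rung R3), PATH-B organ — «SQUARE STABILITY» (LEAD w3 g26 census v5.0 §6 (a); DEFINITION-FREE):
# a chart whose fine plaquettes move at bounded rate under coarse one-bond moves keeps every admissible coarse square's image inside the fine window

Cell `ym3-torus` (YM ladder rung R3 = continuum `SU(2)` Yang–Mills on the three-torus — a RUNG: NOT d = 4, NOT infinite volume, NOT a mass gap, NOT Clay).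
Width seat `ym3-torus-px19` (gen 20); `--kind proof --supports stmt-QuantumFields-20520 --as helper`, count-neutral, no registry ∕ binder ∕ `Lines/` edit, default
heartbeats, `autoImplicit false`.  LOCATE `HOME/ym3-torus-px19/g20/LOCATE-JT-DISCHARGER-DOOR-px19g20.md` a69adec5 §4 (iii); LEAD census v5.0 §6 (a): «D-1: the (JT-h)
discharger — JT-CURV (N3) in shape (s2) (✓p814806); then «square stability» as a named brick (keeps `Φ(V(s,t),z)` in the `θ_Ts∕4` window on `supp ŵ`), then ✓TS for the tail».

WHAT.  For a chart `T : GaugeField P j SU(2) → GaugeField Q i SU(2)` at a fibre point (coarse torus `P` at level `j`, fine torus `Q` at level `i`; in the discharge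
`T := Φ(·, z)`), the HYPOTHESIS «PLAQUETTE DISPLACEMENT CLAUSE» (first order; the integrated edition of ✓p814806's speed letters): on a coarse window `PlaqSmall θc′`,
a one-bond exponential move `U ↦ U·expPt(s•v)@b` (`s ∈ [0,1]`, `‖v‖ ≤ rc·θc`) displaces every fine plaquette of the image by at most `DP p b·(‖v‖∕θc)` in `dist1`:
`dist1 (plaqHol (T (update U b (U b·expPt(s•v)))) p) ≤ dist1 (plaqHol (T U) p) + DP p b·(‖v‖∕θc)`.  CONCLUSIONS:
* ★`plaqSmall_chart_along_square` — if the base image is in a SHRUNK fine window, `T U ∈ PlaqSmall θf₀`, the displacement letters at the two moved bonds are capped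
  (`DP · b ≤ Db`, `DP · b′ ≤ Db′`) and `θf₀ + Db·(‖v‖∕θc) + Db′·(‖v′‖∕θc) ≤ θf`, then EVERY point of the organ's one-bond exponential square family
  `sq U b v b′ v′ s t = update (update U b (U b·expPt(s•v))) b′ (…·expPt(t•v′))`, `(s,t) ∈ [0,1]²` (✓p814806's family) maps into `PlaqSmall θf` — two applications of the
  clause (the intermediate coarse points `U·expPt(s•v)@b ∈ PlaqSmall θc′` are a hypothesis `hsqc`, supplied by ✓`OrganTangentSeedHClause.plaqSmall_move`);
* `plaqSmall_chart_along_square_of_margin` — the size-free margin `θf₀ + (Db + Db′)·rc ≤ θf` (`0 ≤ θc`);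
* `plaqSmall_chart_corners` — in particular the four corners `T U, T(U·e^v@b), T(U·e^{v′}@b′), T(U·e^v@b·e^{v′}@b′)` are in `PlaqSmall θf` (so a fine bond-pair ∕ curvature
  clause of `h_Ts` stated on `PlaqSmall θf` applies to the whole pulled-back square, and the GOOD SET of the (JT-h) discharge is `{z | T_z U ∈ PlaqSmall θf₀}` — its complement
  goes to ✓TS `abs_integral_mul_weight_le_good_add_bad` with the (S)-tail of `ŵ_t`, the `δT` slot).
INPUT LEFT TO PRINT: the displacement letters `DP` of Bałaban's minimiser-following chart ([Balaban1985Variational] Thm 1 (10) p.279 — exponential decay of the minimiser's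
response; Prop 9 (190) p.309; [Balaban1984PropagatorsI] Prop 1.2) — NOT constructed here.

HONEST FRAMING: `dist1`∕`Function.update` bookkeeping over a HYPOTHESIS clause; nothing of Bałaban's analysis is asserted or proved; `SpreadFibreLawH(J)`, LIN″, JEN″, JVARᵘ-H″,
O1ᵘ-H v2.2, S1aᴴ, S3ᴴ, S2α′, S2β, 26243, the five registered stubs, crux 20520 `FluctuationComparisonRegPrIntL` and `YM3TorusSU2` are NOT proved; no summit ∕ sub-problem
statement is proved; registry `Lines/semiclassical_s2beta.lean` 3732b7df untouched; rung R3 = SU(2) YM₃ on T³ at fixed lattice data — NOT d = 4, NOT infinite volume, NOT a mass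
gap, NOT Clay; the Yang–Mills mass gap is NOT proved.  [folklore]
-/

set_option autoImplicit false

noncomputable section

namespace Summit.QuantumFields.YangMills.Theorems.OrganTangentSquareStability

open Function Set
open Literature.MathematicalPhysics.QuantumFieldTheory.Balaban1983to89
open T4CubeChartExp (expPt)
open Summit.QuantumFields.YangMills.Theorems.OrganTangentSeedHClause (corner_fst_zero corner_zero_snd corner_zero_zero)

variable {P Q : Params} {j i : ℕ} [DecidableEq (PBond P j)]

/-- ★ **SQUARE STABILITY.**  Under the chart's PLAQUETTE DISPLACEMENT CLAUSE on the coarse window `θc′` (letters `DP`, caps `Db`, `Db′` at the two moved bonds), a base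
configuration whose image is in the shrunk window `θf₀` and whose `b`-moved one-parameter family stays in `θc′` has ITS WHOLE one-bond exponential square mapped into
`PlaqSmall θf`, provided `θf₀ + Db·(‖v‖∕θc) + Db′·(‖v′‖∕θc) ≤ θf`. [folklore] -/
theorem plaqSmall_chart_along_square {θc θc' rc θf₀ θf : ℝ} (hθc : 0 ≤ θc)
    (T : GaugeField P j (Matrix.specialUnitaryGroup (Fin 2) ℂ) → GaugeField Q i (Matrix.specialUnitaryGroup (Fin 2) ℂ))
    (DP : Plaq Q i → PBond P j → ℝ)
    (hdisp : ∀ (U : GaugeField P j (Matrix.specialUnitaryGroup (Fin 2) ℂ)), PlaqSmall θc' U →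
      ∀ (b : PBond P j) (v : Fin 3 → ℝ), ‖v‖ ≤ rc * θc → ∀ s ∈ Icc (0 : ℝ) 1, ∀ p : Plaq Q i,
        dist1 (GaugeField.plaqHol (T (update U b (U b * expPt (s • v)))) p)
          ≤ dist1 (GaugeField.plaqHol (T U) p) + DP p b * (‖v‖ / θc))
    (b b' : PBond P j) (v v' : Fin 3 → ℝ) (U : GaugeField P j (Matrix.specialUnitaryGroup (Fin 2) ℂ))
    (hv : ‖v‖ ≤ rc * θc) (hv' : ‖v'‖ ≤ rc * θc) (hUc : PlaqSmall θc' U)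
    (hsqc : ∀ s ∈ Icc (0 : ℝ) 1, PlaqSmall θc' (update U b (U b * expPt (s • v))))
    {Db Db' : ℝ} (hDb : ∀ p, DP p b ≤ Db) (hDb' : ∀ p, DP p b' ≤ Db')
    (hTU : PlaqSmall θf₀ (T U)) (hroom : θf₀ + Db * (‖v‖ / θc) + Db' * (‖v'‖ / θc) ≤ θf) :
    ∀ s ∈ Icc (0 : ℝ) 1, ∀ t ∈ Icc (0 : ℝ) 1,
      PlaqSmall θf (T (update (update U b (U b * expPt (s • v))) b' ((update U b (U b * expPt (s • v))) b' * expPt (t • v')))) := by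
  intro s hs t ht p
  have hσ : 0 ≤ ‖v‖ / θc := div_nonneg (norm_nonneg _) hθc
  have hσ' : 0 ≤ ‖v'‖ / θc := div_nonneg (norm_nonneg _) hθc
  -- first move (bond `b`, parameter `s`) from `U`
  have h1 := hdisp U hUc b v hv s hs p
  -- second move (bond `b′`, parameter `t`) from the intermediate configuration
  have h2 := hdisp (update U b (U b * expPt (s • v))) (hsqc s hs) b' v' hv' t ht p
  have hb1 : DP p b * (‖v‖ / θc) ≤ Db * (‖v‖ / θc) := mul_le_mul_of_nonneg_right (hDb p) hσ
  have hb2 : DP p b' * (‖v'‖ / θc) ≤ Db' * (‖v'‖ / θc) := mul_le_mul_of_nonneg_right (hDb' p) hσ'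
  have h0 := hTU p
  linarith

/-- **SQUARE STABILITY, size-free margin**: with `‖v‖, ‖v′‖ ≤ rc·θc` the room condition `θf₀ + (Db + Db′)·rc ≤ θf` suffices (`0 ≤ Db, Db′`). [folklore] -/
theorem plaqSmall_chart_along_square_of_margin {θc θc' rc θf₀ θf : ℝ} (hθc : 0 < θc)
    (T : GaugeField P j (Matrix.specialUnitaryGroup (Fin 2) ℂ) → GaugeField Q i (Matrix.specialUnitaryGroup (Fin 2) ℂ))
    (DP : Plaq Q i → PBond P j → ℝ)
    (hdisp : ∀ (U : GaugeField P j (Matrix.specialUnitaryGroup (Fin 2) ℂ)), PlaqSmall θc' U →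
      ∀ (b : PBond P j) (v : Fin 3 → ℝ), ‖v‖ ≤ rc * θc → ∀ s ∈ Icc (0 : ℝ) 1, ∀ p : Plaq Q i,
        dist1 (GaugeField.plaqHol (T (update U b (U b * expPt (s • v)))) p)
          ≤ dist1 (GaugeField.plaqHol (T U) p) + DP p b * (‖v‖ / θc))
    (b b' : PBond P j) (v v' : Fin 3 → ℝ) (U : GaugeField P j (Matrix.specialUnitaryGroup (Fin 2) ℂ))
    (hv : ‖v‖ ≤ rc * θc) (hv' : ‖v'‖ ≤ rc * θc) (hUc : PlaqSmall θc' U)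
    (hsqc : ∀ s ∈ Icc (0 : ℝ) 1, PlaqSmall θc' (update U b (U b * expPt (s • v))))
    {Db Db' : ℝ} (hDb0 : 0 ≤ Db) (hDb0' : 0 ≤ Db') (hDb : ∀ p, DP p b ≤ Db) (hDb' : ∀ p, DP p b' ≤ Db')
    (hTU : PlaqSmall θf₀ (T U)) (hroom : θf₀ + (Db + Db') * rc ≤ θf) :
    ∀ s ∈ Icc (0 : ℝ) 1, ∀ t ∈ Icc (0 : ℝ) 1,
      PlaqSmall θf (T (update (update U b (U b * expPt (s • v))) b' ((update U b (U b * expPt (s • v))) b' * expPt (t • v')))) := by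
  refine plaqSmall_chart_along_square hθc.le T DP hdisp b b' v v' U hv hv' hUc hsqc hDb hDb' hTU ?_
  have hσ : ‖v‖ / θc ≤ rc := by rw [div_le_iff₀ hθc]; exact hv
  have hσ' : ‖v'‖ / θc ≤ rc := by rw [div_le_iff₀ hθc]; exact hv'
  have h1 : Db * (‖v‖ / θc) ≤ Db * rc := mul_le_mul_of_nonneg_left hσ hDb0
  have h2 : Db' * (‖v'‖ / θc) ≤ Db' * rc := mul_le_mul_of_nonneg_left hσ' hDb0'
  linarith

/-- **The four corners** of an admissible square are mapped into `PlaqSmall θf` (the instances `(s,t) ∈ {0,1}²` of ★`plaqSmall_chart_along_square`; so a fine clause of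
`h_Ts` stated on `PlaqSmall θf` applies to the pulled-back square, and `{z | T_z U ∈ PlaqSmall θf₀}` is the GOOD SET of the (JT-h) discharge). [folklore] -/
theorem plaqSmall_chart_corners {θc θc' rc θf₀ θf : ℝ} (hθc : 0 ≤ θc)
    (T : GaugeField P j (Matrix.specialUnitaryGroup (Fin 2) ℂ) → GaugeField Q i (Matrix.specialUnitaryGroup (Fin 2) ℂ))
    (DP : Plaq Q i → PBond P j → ℝ)
    (hdisp : ∀ (U : GaugeField P j (Matrix.specialUnitaryGroup (Fin 2) ℂ)), PlaqSmall θc' U →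
      ∀ (b : PBond P j) (v : Fin 3 → ℝ), ‖v‖ ≤ rc * θc → ∀ s ∈ Icc (0 : ℝ) 1, ∀ p : Plaq Q i,
        dist1 (GaugeField.plaqHol (T (update U b (U b * expPt (s • v)))) p)
          ≤ dist1 (GaugeField.plaqHol (T U) p) + DP p b * (‖v‖ / θc))
    (b b' : PBond P j) (v v' : Fin 3 → ℝ) (U : GaugeField P j (Matrix.specialUnitaryGroup (Fin 2) ℂ))
    (hv : ‖v‖ ≤ rc * θc) (hv' : ‖v'‖ ≤ rc * θc) (hUc : PlaqSmall θc' U)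
    (hsqc : ∀ s ∈ Icc (0 : ℝ) 1, PlaqSmall θc' (update U b (U b * expPt (s • v))))
    {Db Db' : ℝ} (hDb : ∀ p, DP p b ≤ Db) (hDb' : ∀ p, DP p b' ≤ Db')
    (hTU : PlaqSmall θf₀ (T U)) (hroom : θf₀ + Db * (‖v‖ / θc) + Db' * (‖v'‖ / θc) ≤ θf) :
    PlaqSmall θf (T U) ∧ PlaqSmall θf (T (update U b (U b * expPt v))) ∧ PlaqSmall θf (T (update U b' (U b' * expPt v'))) ∧
      PlaqSmall θf (T (update (update U b (U b * expPt v)) b' ((update U b (U b * expPt v)) b' * expPt v'))) := by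
  have key := plaqSmall_chart_along_square hθc T DP hdisp b b' v v' U hv hv' hUc hsqc hDb hDb' hTU hroom
  have h0 : (0 : ℝ) ∈ Icc (0 : ℝ) 1 := ⟨le_rfl, zero_le_one⟩
  have h1 : (1 : ℝ) ∈ Icc (0 : ℝ) 1 := ⟨zero_le_one, le_rfl⟩
  refine ⟨?_, ?_, ?_, ?_⟩
  · have h := key 0 h0 0 h0
    rwa [corner_zero_zero] at h
  · have h := key 1 h1 0 h0
    rwa [corner_fst_zero, one_smul] at h
  · have h := key 0 h0 1 h1
    rwa [corner_zero_snd, one_smul] at h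
  · have h := key 1 h1 1 h1
    rwa [one_smul, one_smul] at h

end Summit.QuantumFields.YangMills.Theorems.OrganTangentSquareStability

/-! ## §2 v1.1 APPEND — far pairs: a WINDOW-TO-WINDOW displacement letter moves the base point from the law point `Xw` to any window point `U`
(LEAD DISCHARGE SPEC v1.0 D1 / TN-WINDOW-PAIRS: (JT-h)'s law point `Xw` and (JV0-h)–(JV2-h)'s value points range over the WHOLE `θ_j∕4`-window, not only over the corners of
one square; the consumer `integrable_logRatio_mul_wgt_of_squareStability` (LEAD №17) is based at `Xw`: `mwCut (Φ (Xw, z)) ≠ 0 → dist1 (plaqHol (Φ (X, z)) p) ≤ c·θBal_Ts`) -/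

namespace Summit.QuantumFields.YangMills.Theorems.OrganTangentSquareStability

open Function Set
open Literature.MathematicalPhysics.QuantumFieldTheory.Balaban1983to89
open T4CubeChartExp (expPt)

variable {P Q : Params} {j i : ℕ} [DecidableEq (PBond P j)]

omit [DecidableEq (PBond P j)] in
/-- **WINDOW-TO-WINDOW DISPLACEMENT**: under the HYPOTHESIS «uniform window-to-window displacement letter `Dw`» of the chart (`∀ U U′` in the coarse window `θc`,
every fine plaquette of `T U′` is within `Dw` of the corresponding one of `T U` in `dist1`), an image `T Xw ∈ PlaqSmall θw` at ONE window point puts `T U ∈ PlaqSmall (θw + Dw)`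
at EVERY window point `U`.  (In the abelian count `Dw ≍ θ_j∕n² ≪ θ_Ts`, m-uniform; the letter itself is [Balaban1985Variational] Thm 1 (10) ∕ Prop 9 (190), NOT constructed here.)
[folklore] -/
theorem plaqSmall_chart_of_window_displacement {θc θw Dw : ℝ}
    (T : GaugeField P j (Matrix.specialUnitaryGroup (Fin 2) ℂ) → GaugeField Q i (Matrix.specialUnitaryGroup (Fin 2) ℂ))
    (hglob : ∀ (U U' : GaugeField P j (Matrix.specialUnitaryGroup (Fin 2) ℂ)), PlaqSmall θc U → PlaqSmall θc U' →
      ∀ p : Plaq Q i, dist1 (GaugeField.plaqHol (T U') p) ≤ dist1 (GaugeField.plaqHol (T U) p) + Dw)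
    (Xw U : GaugeField P j (Matrix.specialUnitaryGroup (Fin 2) ℂ)) (hXw : PlaqSmall θc Xw) (hU : PlaqSmall θc U)
    (hTXw : PlaqSmall θw (T Xw)) : PlaqSmall (θw + Dw) (T U) := fun p => by
  have h1 := hglob Xw U hXw hU p
  have h2 := hTXw p
  linarith

/-- ★ **SQUARE STABILITY FROM THE LAW POINT** (the docking form of LEAD №17's `hstab`): window-to-window letter `Dw` + the one-bond plaquette displacement clause on `θc′ ⊇`
the `θc`-window + `T Xw ∈ PlaqSmall θw` at the law point + room `θw + Dw + (Db + Db′)·rc ≤ θf` ⟹ EVERY admissible square based at ANY `θc`-window point `U` maps into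
`PlaqSmall θf` along its whole one-bond exponential family (hence at its four corners, ✓`plaqSmall_chart_corners`'s pattern; strict `<` gives the consumer's `≤ c·θBal_Ts`).
[folklore] -/
theorem plaqSmall_chart_along_square_of_lawPoint {θc θc' rc θw Dw θf : ℝ} (hθc : 0 < θc) (hcc' : θc ≤ θc')
    (T : GaugeField P j (Matrix.specialUnitaryGroup (Fin 2) ℂ) → GaugeField Q i (Matrix.specialUnitaryGroup (Fin 2) ℂ))
    (DP : Plaq Q i → PBond P j → ℝ)
    (hdisp : ∀ (U : GaugeField P j (Matrix.specialUnitaryGroup (Fin 2) ℂ)), PlaqSmall θc' U →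
      ∀ (b : PBond P j) (v : Fin 3 → ℝ), ‖v‖ ≤ rc * θc → ∀ s ∈ Icc (0 : ℝ) 1, ∀ p : Plaq Q i,
        dist1 (GaugeField.plaqHol (T (update U b (U b * expPt (s • v)))) p)
          ≤ dist1 (GaugeField.plaqHol (T U) p) + DP p b * (‖v‖ / θc))
    (hglob : ∀ (U U' : GaugeField P j (Matrix.specialUnitaryGroup (Fin 2) ℂ)), PlaqSmall θc U → PlaqSmall θc U' →
      ∀ p : Plaq Q i, dist1 (GaugeField.plaqHol (T U') p) ≤ dist1 (GaugeField.plaqHol (T U) p) + Dw)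
    (Xw : GaugeField P j (Matrix.specialUnitaryGroup (Fin 2) ℂ)) (hXw : PlaqSmall θc Xw) (hTXw : PlaqSmall θw (T Xw))
    (b b' : PBond P j) (v v' : Fin 3 → ℝ) (U : GaugeField P j (Matrix.specialUnitaryGroup (Fin 2) ℂ))
    (hv : ‖v‖ ≤ rc * θc) (hv' : ‖v'‖ ≤ rc * θc) (hU : PlaqSmall θc U)
    (hsqc : ∀ s ∈ Icc (0 : ℝ) 1, PlaqSmall θc' (update U b (U b * expPt (s • v))))
    {Db Db' : ℝ} (hDb0 : 0 ≤ Db) (hDb0' : 0 ≤ Db') (hDb : ∀ p, DP p b ≤ Db) (hDb' : ∀ p, DP p b' ≤ Db')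
    (hroom : θw + Dw + (Db + Db') * rc ≤ θf) :
    ∀ s ∈ Icc (0 : ℝ) 1, ∀ t ∈ Icc (0 : ℝ) 1,
      PlaqSmall θf (T (update (update U b (U b * expPt (s • v))) b' ((update U b (U b * expPt (s • v))) b' * expPt (t • v')))) := by
  have hTU : PlaqSmall (θw + Dw) (T U) := plaqSmall_chart_of_window_displacement T hglob Xw U hXw hU hTXw
  have hUc' : PlaqSmall θc' U := fun p => lt_of_lt_of_le (hU p) hcc'
  exact plaqSmall_chart_along_square_of_margin hθc T DP hdisp b b' v v' U hv hv' hUc' hsqc hDb0 hDb0' hDb hDb' hTU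
    (by linarith)

end Summit.QuantumFields.YangMills.Theorems.OrganTangentSquareStability

end
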